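import Literature.MathematicalPhysics.QuantumFieldTheory.Balaban1983to89.B8Prop6DentedCubeMemberScalarGammaOfNamedFactsRec
import Literature.MathematicalPhysics.QuantumFieldTheory.Balaban1983to89.B8Prop6DentedCubeMemberScalarGammaRec
import Literature.MathematicalPhysics.QuantumFieldTheory.Balaban1983to89.B8Prop6DentedCubeMemberGaugedRealGammaGRec
import Literature.MathematicalPhysics.QuantumFieldTheory.Balaban1983to89.B8Ineq159FlatCovDentedCubeMemberRec

/-!
# `Balaban1983to89.B8Prop6DentedCubeMemberScalarGammaOfNamedFactsGRec` — THE RECORD `G`-CROWN ([Balaban1985RegularSpaces] PROPOSITION 6 (1.135)–(1.138) p. 99 ∕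
# [Balaban1985Variational] (148)–(153) at every dented centred cube member of print's p. 98 sub-lattice, odd `L ≥ 5`, `d ≥ 2`, FOR `G`-VALUED GAUGE FIELDS WITH A `G`-VALUED
# GAUGE TRANSFORMATION — joint J-SU, [Balaban1985Averaging] p. 20 «We consider a Lie subgroup G of a unitary group U(N)»; print's case of record `G = SU(N)`): the `G`-edition
# of `B8Prop6DentedCubeMemberScalarGammaOfNamedFactsRec` (conditional on the two named Cov facts BY NAME) AND its unconditional form over dag-n05-cov's
# `ineq159FlatCovPrintedZ_holds`, FOR THE SYMMETRISED CENTRED block averaging (0.4) of [Balaban1987RG1]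

statement-level skeleton of published theorems with citation tags; proofs where landed; nothing here is a claim about the Yang–Mills mass gap

T. Bałaban, *Spaces of regular gauge field configurations on a lattice and gauge fixing conditions*, Commun. Math. Phys. **99** (1985) 75–102 `[Balaban1985RegularSpaces]`
("[6]"): Prop. 6 (1.135)–(1.138) p. 99, p. 98, (1.59) p. 86, (1.62) p. 87, (1.91)–(1.92) p. 91, (1.98) p. 92, (1.101) p. 93, (1.4) p. 77, (1.17) p. 78; T. Bałaban, *The variational
problem and background fields in renormalization group method for lattice gauge theories*, Commun. Math. Phys. **102** (1985) 277–309 `[Balaban1985Variational]` ("[15]"):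
(148)–(153) p. 301, p. 300; T. Bałaban, *Averaging operations for lattice gauge theories*, Commun. Math. Phys. **98** (1985) 17–51 `[Balaban1985Averaging]` ("[3]"): p. 20,
(42)–(43) pp. 23–24; T. Bałaban, *Propagators for lattice gauge theories in a background field*, Commun. Math. Phys. **99** (1985) 389–434 `[Balaban1985BackgroundPropagators]`
("[4]"): (3.14)–(3.15) p. 393, Thms 3.1–3.3 pp. 398–399; T. Bałaban, *Propagators and renormalization transformations for lattice gauge theories. II*, Commun. Math. Phys.
**96** (1984) 223–250 `[Balaban1984PropagatorsII]`: Prop. 2.6 (2.136) p. 247; T. Bałaban, *Renormalization group approach to lattice gauge field theories. I*, Commun. Math. Phys.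
**109** (1987) 249–301 `[Balaban1987RG1]` ("[I]"): (0.3)–(0.4) pp. 252–253.  STATUS: published, refereed.

CITATION HEADER (lean-in-tree rule).  Cell `pub-ymgap`, «N05-REC» R8 = the `G`∕τ-EDITION OF RECORD (desk `R6-PLAN.md` §6 (B)), file G7 with the announced G6
(`B8Prop6DentedCubeMemberScalarGammaGRec`) FOLDED IN as §0 (one module fewer on a lagging farm; basename struck on the bus) — LEAD PEN dag-n05-e g40.  WHAT IS REPRODUCED = §0: ★★
`gaugedBoundB8D_dentedMember_scalar_γ_mem` — ✓`B8Prop6DentedCubeMemberScalarGammaRec.gaugedBoundB8D_dentedMember_scalar_γ` with the joint J-SU data threaded as the engine's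
`B8Prop6CubeMemberScalarGammaG` (this seat g33), over (G5) `gaugedBoundB8D_dentedMember_real_γ_mem` and the scalar `⊗ id` transfers `flat159Z_clause(4)_of_scalar_bdryβ` BY NAME; §1–§3: ✓`B8Prop6DentedCubeMemberScalarGammaOfNamedFactsRec` §1–§3 (this seat g39) VERBATIM with the joint J-SU data `(τ, hτ, G, H, hGrp2, hGrp3, hGA : AvgClosedZ d L G,
hGH, hGu, hexpG)` threaded as parameters, `U₀ ∈ G`, and the conclusion = `Node00.GaugedBoundB8DZ`'s ∃-body with `u ∈ G`, `(c.vfix U₀)⁻¹·u ∈ G` (over §0's `gaugedBoundB8D_dentedMember_scalar_γ_mem`; the record REAL families `prop6_real123_printedZ` ∕ `real123DentedCubeMemberPrintedZ_holds`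
and the scalar clauses `sc4_dented_of_ineq159Printed` BY NAME): ★ `…_of_real123_mem`, ★★ `…_of_namedFacts_mem`, ★★★ `gaugedBoundB8DZ_dentedMember_of_cov159_mem` (CONDITIONAL
on the two named Cov facts BY NAME, as the unitary crown p732588); §4 ★★★ `gaugedBoundB8DZ_dentedMember_scalar_γ_holds_mem` — UNCONDITIONAL, the two named facts discharged by
dag-n05-cov's `B8Ineq159FlatCovDentedCubeMemberRec.ineq159FlatCovPrintedZ_holds` (✓p734150) exactly as in their `B8Prop6DentedCubeMemberScalarGammaHoldsRec` (✓p734925).  The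
`M_N(ℂ)`, `G = SU(N)`, `τ = tr` instance is (G8).  Kind «kernel-checked proof», theorems only: no `def`, no `… : Prop` fact, no `instance`, no `notation`, no existing module
modified.  `--supports stmt-QuantumFields-20541` (K0⁷-keyed, COUNT-NEUTRAL).

HONEST SCOPE.  Bookkeeping compositions; NO new estimate; §4 is unconditional as a Literature theorem about the record's Prop-6 crown for `G`-valued fields — STILL NOT a
node discharge: `HThm4Rec` UNDISCHARGED; N05 ∕ N07 NOT discharged; K0⁷'s stubs untouched; COUNT of record unmoved; one finite `𝕋⁴` programme at fixed `ε`, Bałaban AS PRINTED;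
nothing continuum ∕ ℝ⁴ ∕ OS ∕ mass-gap ∕ Clay.  No `sorry`, no `def`.
-/

noncomputable section

open NormedSpace
open scoped BigOperators

namespace Literature.MathematicalPhysics.QuantumFieldTheory.Balaban1983to89.B8Prop6DentedCubeMemberScalarGammaOfNamedFactsGRec

open scoped Matrix
open MatrixLog B7Prop1Explicit B7Prop2Explicit B7Prop1Local B7Eq92Concrete
open BlockAveragingZd (ctrShift)
open B7Prop4GeneralLevelsRec (cZ gZ KZ gZ_nonneg)
open B7SectEFLinearisationRec (linCovIterZ)
open B8Ineq132 (covDerivFwd InAk BondTouches)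
open B8Eq140Level (SideTouches)
open B8Eq143PlaqExpansion (pdiv)
open B8Eq146AExpansion (iEta plaqCovDeriv)
open B8Eq155JBound (Jcur wsup)
open B8ScaledSupNorm (bondNorm msup)
open B8Eq138LandauZd (covLap)
open B8Eq138LandauZdRec (IsLandau138Z)
open B8LambdaSpaceKLevel (wt)
open B8Eq131CubesAdmissibleRec (cubeFamZ cubeFam_false_of_le)
open B8Eq119TwistedAxialRec (flmZ)
open B8Eq1101CubeMemberWeights (wPrinted wPrinted_facts)
open B8Real123FlatTranslateRec (Real123Block)
open B8Real123CubeMemberRec (prop6_real123_printedZ Real123DentedCubeMemberPrintedZ real123DentedCubeMemberPrintedZ_holds)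
open B8Ineq159FlatCovPrintedRec (Ineq159FlatCubeMemberCovPrintedZ Ineq159FlatDentedCubeMemberCovPrintedZ)
open B8Ineq159FlatDentedCubeMemberSCGammaRec (lamBPF_sub_splitIndex sc4_dented_of_ineq159Printed)
open B8DentedCubeMemberZdRec (lamST_of_lt lamST_top_apply)
open B9SupplySockB9P3ZdBeta (CrossB)
open Node00 (CubeB8DZ GaugedBoundB8DZ)
open Literature.MathematicalPhysics.QuantumLattice (blockMap)
open B8Eq184Proof (gaugeExp cfgExp)
open B7Prop1Explicit (expUnit)
open B7Prop2Rec (AvgClosedZ)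
open MatrixLog (mlog)
open B8Eq131Cubes (tLo tHi)
open B8Eq131CubesRec (bLoZ bHiZ)
open B8Ineq130Rec (tlo thi)
open B8Eq119TwistedAxialRec (Restr129Z)
open B8Eq138LandauZd (logCfg)
open B8Eq138LandauZdRec (IsLandau138WZ)
open B7SectEFLinearisationRec (logCovIterZ)
open BlockAveragingZd (avgIterZ)
open B8Ineq159FlatCovDentedCubeMemberRec (ineq159FlatCovPrintedZ_holds)

open B7Prop2Explicit (c2' c2'_pos)
open B7Prop2Rec (C0Z C0Z_pos)
open B7Prop3Flat (c3)
open B8Ineq133Rec (cutFixedZ)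
open B8Eq115GaugeFixingRec (localGaugeZ)
open B8Lemma1NonAbelian (mulCfg)
open B8Eq119TwistedAxialRec (Restr129Z flmZ)
open B8Eq184Proof (cfgExp)
open B8Eq138LandauZd (covLap logCfg)
open B8Eq138LandauZdRec (IsLandau138WZ IsLandau138Z)
open B8Eq131Cubes (tLo tHi ctr)
open B8Prop6OfThm4 (const_136 smallness_134)
open B8Prop6DentedCubeMemberGaugedRealGammaGRec (gaugedBoundB8D_dentedMember_real_γ_mem)
open B8Ineq159FlatOfScalarBdryBetaRec (flat159Z_clause_of_scalar_bdryβ)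
open B8Ineq159Flat4OfScalarBdryBetaRec (flat159Z_clause4_of_scalar_bdryβ)
open B8Eq184Proof (gaugeExp)
export B7Prop1Explicit (Site)

variable {d : ℕ}

variable {𝔸 : Type} [CStarAlgebra 𝔸] [Nontrivial 𝔸]

/-! ## §0 (G6 folded in) `GaugedBoundB8DZ`'s body with `u ∈ G` at every dented record cube from scalar clauses + real families — twin of `B8Prop6CubeMemberScalarGammaG` -/

open Classical in
/-- ★★ (RECORD TWIN of `B8Prop6CubeMemberScalarGammaG.gaugedBoundB8_cubeMember_scalar_γ_mem`, at the DENTED record member.) **PROPOSITION 6 (p. 99), (1.135)–(1.138) ∕ [15]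
(152)–(153) AT EVERY DENTED RECORD CUBE WITH A `G`-VALUED GAUGE TRANSFORMATION, FROM THE SCALAR FLAT γ CLAUSES AND THE THREE REAL INEQUALITY FAMILIES — NO GAUGE-FIELD
HYPOTHESIS** ([Balaban1985Averaging] p. 20 «a Lie subgroup G of a unitary group U(N)»).  ✓`B8Prop6DentedCubeMemberScalarGammaRec.gaugedBoundB8D_dentedMember_scalar_γ` VERBATIM
(the four-line flat socket SERVED by `flat159Z_clause4_of_scalar_bdryβ`, `H59Dβ₁` SERVED by `flat159Z_clause_of_scalar_bdryβ` — both class-parametric `⊗ id` transfers,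
`u`-free) except: the joint J-SU data `(τ) (hτ) {G H} (hGrp2) (hGrp3) (hGA : AvgClosedZ d L G) (hGH) (hGu) (hexpG)` are parameters, `U₀` is `G`-valued, and the conclusion
is `Node00.GaugedBoundB8DZ`'s body spelled out with `u ∈ G`, `v⁻¹u ∈ G`; over (G5) `gaugedBoundB8D_dentedMember_real_γ_mem`.
[cite: Balaban1985RegularSpaces, Prop. 6 (1.135)–(1.138) p.99, Thm 4 p.88, Prop. 3 p.87, Prop. 5 p.93, (1.58)–(1.59) p.86, (1.31) p.82; Balaban1985Variational, (148)–(153) p.301; Balaban1985Averaging, p.20; Balaban1985BackgroundPropagators, Thms 3.1–3.3 pp.397–399, p.394 («⊗ identity»); Balaban1987RG1, (0.3)–(0.4) pp.252–253] -/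
theorem gaugedBoundB8D_dentedMember_scalar_γ_mem (τ : 𝔸 →L[ℂ] ℂ) (hτ : ∀ x y : 𝔸, τ (x * y) = τ (y * x)) (hd2 : 2 ≤ d) {L sL : ℕ} (hLs : L = 2 * sL + 1)
    (hs1 : 1 ≤ sL)
    {G H : Subgroup 𝔸ˣ} (hGrp2 : ∀ g ∈ H, ‖(g : 𝔸) - 1‖ ≤ 1 / 8 → τ (mlog (g : 𝔸)) = 0) (hGrp3 : ∀ S : 𝔸, τ S = 0 → expUnit S ∈ H)
    (hGA : AvgClosedZ d L G) (hGH : G ≤ H) (hGu : G ≤ unitaryUnits 𝔸)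
    (hexpG : ∀ lam : Site d → 𝔸, (∀ x, IsSelfAdjoint (lam x)) → (∀ x, τ (lam x) = 0) → ∀ x, gaugeExp lam x ∈ G)
    {B₀ B₀' C₂ B₀'H B₂' BG BR Bbd : ℝ} (hB₀ : 0 < B₀)
    (hB₀' : 0 < B₀') (hB : 2 ≤ 5 * (d : ℝ) * L * B₀) (hC₂ : 2 * ((1 + 2 * gZ d L) * (2 * (131072 * ((d : ℝ) + 1) ^ 2) * (KZ d L) ^ 2)) * (L : ℝ) ^ 2 ≤ C₂)
    (hB₀'H : 0 < B₀'H) (hB₂' : 0 ≤ B₂') (hBG : 0 ≤ BG) (hBR : 0 ≤ BR) (hfree : 3 * (2 * (d : ℝ) * (L : ℝ) ^ 2) * BG * BR ≤ B₀')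
    (hBbd : 0 ≤ Bbd) (hBd : 4 * Bbd ≤ ((d : ℝ) * L - 1) * B₀) :
    ∃ c₁ : ℝ, 0 < c₁ ∧ ∀ (η : ℝ), 0 < η → ∀ {K : ℕ} {Ω : ℕ → Set (Site d)} (c : CubeB8DZ d L K Ω),
      -- THE SCALAR FLAT FOUR-LINE (1.59) CLAUSE OF PROPOSITION 3's FRAME at the cube's top truncation `c.k`: ℂ-valued bond functions in the
      -- flat Landau gauge on the collars of `{□_j}`, exterior-collar allowance on each line ([4] Thm 3.3 at `U = 1` for `G(1)`, `H(1)`, a priori)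
      (∀ φ : Site d → Fin d → ℂ,
        IsLandau138Z L c.k η (c.sq 0) c.lamS (1 : Site d → Fin d → ℂˣ) φ →
        (∀ (y : Site d) (τ : Fin d), (∀ j, j ≤ c.k → ¬ SideTouches (c.sq j) y τ) → φ y τ = 0) →
        msup L c.k η (-(1 : ℝ)) (fun j (b : Site d × Fin d) => SideTouches (c.sq j) b.1 b.2) (fun b => φ b.1 b.2)
          ≤ B₀ * (bondNorm L c.k η (-(3 : ℝ)) c.sq (fun x μ => Jcur η (1 : Site d → Fin d → ℂˣ) φ μ x)
            + wsup 1 (fun p : {p : ℕ × (Site d × Fin d) // p.1 ≤ c.k ∧ (p.2 ∈ c.lamBPT c.k p.1 ∨ (p.1 = 0 ∧ CrossB (c.sq 0) p.2))} =>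
                linCovIterZ L (1 : Site d → Fin d → ℂˣ) (iEta η φ) p.1.1 p.1.2.1 p.1.2.2))
            + Bbd * msup L c.k η (-(1 : ℝ)) (fun j (b : Site d × Fin d) => j = 0 ∧ SideTouches (c.sq 0) b.1 b.2 ∧
                ¬ BondTouches (c.sq 0) b.1 b.2) (fun b => φ b.1 b.2) ∧
        msup L c.k η (-(2 : ℝ)) (fun j (t : Fin d × Fin d × Site d) => SideTouches (c.sq j) t.2.2 t.2.1)
            (fun t => covDerivFwd η (1 : Site d → Fin d → ℂˣ) t.1 (fun z => φ z t.2.1) t.2.2)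
          ≤ B₀ * (bondNorm L c.k η (-(3 : ℝ)) c.sq (fun x μ => Jcur η (1 : Site d → Fin d → ℂˣ) φ μ x)
            + wsup 1 (fun p : {p : ℕ × (Site d × Fin d) // p.1 ≤ c.k ∧ (p.2 ∈ c.lamBPT c.k p.1 ∨ (p.1 = 0 ∧ CrossB (c.sq 0) p.2))} =>
                linCovIterZ L (1 : Site d → Fin d → ℂˣ) (iEta η φ) p.1.1 p.1.2.1 p.1.2.2))
            + Bbd * msup L c.k η (-(1 : ℝ)) (fun j (b : Site d × Fin d) => j = 0 ∧ SideTouches (c.sq 0) b.1 b.2 ∧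
                ¬ BondTouches (c.sq 0) b.1 b.2) (fun b => φ b.1 b.2) ∧
        bondNorm L c.k η (-(3 : ℝ)) c.sq (fun x μ => pdiv η (1 : Site d → Fin d → ℂˣ) (plaqCovDeriv η (1 : Site d → Fin d → ℂˣ) φ) μ x)
          ≤ B₀ * (bondNorm L c.k η (-(3 : ℝ)) c.sq (fun x μ => Jcur η (1 : Site d → Fin d → ℂˣ) φ μ x)
            + wsup 1 (fun p : {p : ℕ × (Site d × Fin d) // p.1 ≤ c.k ∧ (p.2 ∈ c.lamBPT c.k p.1 ∨ (p.1 = 0 ∧ CrossB (c.sq 0) p.2))} =>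
                linCovIterZ L (1 : Site d → Fin d → ℂˣ) (iEta η φ) p.1.1 p.1.2.1 p.1.2.2))
            + Bbd * msup L c.k η (-(1 : ℝ)) (fun j (b : Site d × Fin d) => j = 0 ∧ SideTouches (c.sq 0) b.1 b.2 ∧
                ¬ BondTouches (c.sq 0) b.1 b.2) (fun b => φ b.1 b.2) ∧
        bondNorm L c.k η (-(3 : ℝ)) c.sq (fun x μ => covLap η (1 : Site d → Fin d → ℂˣ) (fun z => φ z μ) x)
          ≤ B₀ * (bondNorm L c.k η (-(3 : ℝ)) c.sq (fun x μ => Jcur η (1 : Site d → Fin d → ℂˣ) φ μ x)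
            + wsup 1 (fun p : {p : ℕ × (Site d × Fin d) // p.1 ≤ c.k ∧ (p.2 ∈ c.lamBPT c.k p.1 ∨ (p.1 = 0 ∧ CrossB (c.sq 0) p.2))} =>
                linCovIterZ L (1 : Site d → Fin d → ℂˣ) (iEta η φ) p.1.1 p.1.2.1 p.1.2.2))
            + Bbd * msup L c.k η (-(1 : ℝ)) (fun j (b : Site d × Fin d) => j = 0 ∧ SideTouches (c.sq 0) b.1 b.2 ∧
                ¬ BondTouches (c.sq 0) b.1 b.2) (fun b => φ b.1 b.2)) →
      ∀ (U₀ : Site d → Fin d → 𝔸ˣ), (∀ x κ, U₀ x κ ∈ G) → ∀ (α₀ : ℝ), 0 < α₀ → InAk L K η α₀ Ω U₀ →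
      7 * d * (L : ℝ) ^ 2 * c.M * α₀ ≤ c₁ →
      -- the weights of `Q′ᵀwQ′` and THE THREE REAL INEQUALITY FAMILIES at every truncation `n ≤ k`, CENTRED labels (`Real123Block`)
      ∀ (w : ℕ → ℝ), (∀ j, 0 ≤ w j) →
      (∀ n, 1 ≤ n → n ≤ c.k → Real123Block L (flmZ L) η n w c.sq (c.lamST n) BG B₀'H B₂' BR) →
      -- THE SCALAR FLAT TWO-LINE (1.59) CLAUSE OF THEOREM 4's FRAME at every truncation `m ≤ c.k` (ℂ-valued, flat Landau gauge, collar allowance)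
      (∀ m, 1 ≤ m → m ≤ c.k → ∀ φ : Site d → Fin d → ℂ,
        IsLandau138Z L m η (c.sq 0) (c.lamST m) (1 : Site d → Fin d → ℂˣ) φ →
        (∀ (y : Site d) (τ : Fin d), (∀ j, j ≤ m → ¬ SideTouches (c.sq j) y τ) → φ y τ = 0) →
        msup L m η (-(1 : ℝ)) (fun j (b : Site d × Fin d) => SideTouches (c.sq j) b.1 b.2) (fun b => φ b.1 b.2)
          ≤ B₀ * (bondNorm L m η (-(3 : ℝ)) c.sq (fun x μ => Jcur η (1 : Site d → Fin d → ℂˣ) φ μ x)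
            + wsup 1 (fun p : {p : ℕ × (Site d × Fin d) // p.1 ≤ m ∧ (p.2 ∈ c.lamBPT m p.1 ∨ (p.1 = 0 ∧ CrossB (c.sq 0) p.2))} =>
                linCovIterZ L (1 : Site d → Fin d → ℂˣ) (iEta η φ) p.1.1 p.1.2.1 p.1.2.2))
            + Bbd * msup L m η (-(1 : ℝ)) (fun j (b : Site d × Fin d) => j = 0 ∧ SideTouches (c.sq 0) b.1 b.2 ∧
                ¬ BondTouches (c.sq 0) b.1 b.2) (fun b => φ b.1 b.2) ∧
        msup L m η (-(2 : ℝ)) (fun j (t : Fin d × Fin d × Site d) => SideTouches (c.sq j) t.2.2 t.2.1)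
            (fun t => covDerivFwd η (1 : Site d → Fin d → ℂˣ) t.1 (fun z => φ z t.2.1) t.2.2)
          ≤ B₀ * (bondNorm L m η (-(3 : ℝ)) c.sq (fun x μ => Jcur η (1 : Site d → Fin d → ℂˣ) φ μ x)
            + wsup 1 (fun p : {p : ℕ × (Site d × Fin d) // p.1 ≤ m ∧ (p.2 ∈ c.lamBPT m p.1 ∨ (p.1 = 0 ∧ CrossB (c.sq 0) p.2))} =>
                linCovIterZ L (1 : Site d → Fin d → ℂˣ) (iEta η φ) p.1.1 p.1.2.1 p.1.2.2))
            + Bbd * msup L m η (-(1 : ℝ)) (fun j (b : Site d × Fin d) => j = 0 ∧ SideTouches (c.sq 0) b.1 b.2 ∧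
                ¬ BondTouches (c.sq 0) b.1 b.2) (fun b => φ b.1 b.2)) →
      ∃ u : Site d → 𝔸ˣ, (∀ x, u x ∈ G) ∧ (∀ x, x ∉ c.sq 0 → u x = 1) ∧
        Restr129Z L c.k c.lamS (1 : Site d → Fin d → 𝔸ˣ) u ∧
        IsLandau138WZ L c.k η (c.sq 0) c.lamS (1 : Site d → Fin d → 𝔸ˣ) (c.fixed U₀ u) ∧
        (∀ j, j ≤ c.k → ∀ b ∈ {b : Site d × Fin d | SideTouches (c.sq j) b.1 b.2},
          c.fixed U₀ u b.1 b.2 = cfgExp η (logCfg η (c.fixed U₀ u)) b.1 b.2 ∧ IsSelfAdjoint (logCfg η (c.fixed U₀ u) b.1 b.2) ∧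
            ‖logCfg η (c.fixed U₀ u) b.1 b.2‖ ≤ (7 * d * (L : ℝ) ^ 2 * (5 * (d : ℝ) * L * B₀) * c.M * α₀) * ((L : ℝ) ^ j * η)⁻¹) ∧
        (∀ x, ((c.vfix U₀)⁻¹ * u) x ∈ G) ∧
        AgreeOn (tlo L (tLo c.a c.ρ) c.k) (thi L (tHi c.a c.M c.ρ) c.k) (gaugeAct ((c.vfix U₀)⁻¹ * u)⁻¹ U₀) (c.fixed U₀ u) ∧
        msup L c.k η (-(2 : ℝ)) (fun j (t : Fin d × Fin d × Site d) => SideTouches (c.sq j) t.2.2 t.2.1)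
            (fun t => covDerivFwd η (1 : Site d → Fin d → 𝔸ˣ) t.1 (fun z => c.expo η U₀ u z t.2.1) t.2.2) ≤ (7 * d * (L : ℝ) ^ 2 * (5 * (d : ℝ) * L * B₀) * c.M * α₀) ∧
        bondNorm L c.k η (-(3 : ℝ)) c.sq
            (fun x μ => pdiv η (1 : Site d → Fin d → 𝔸ˣ) (plaqCovDeriv η (1 : Site d → Fin d → 𝔸ˣ) (c.expo η U₀ u)) μ x) ≤ (7 * d * (L : ℝ) ^ 2 * (5 * (d : ℝ) * L * B₀) * c.M * α₀) ∧
        bondNorm L c.k η (-(3 : ℝ)) c.sq (fun x μ => covLap η (1 : Site d → Fin d → 𝔸ˣ) (fun z => c.expo η U₀ u z μ) x) ≤ (7 * d * (L : ℝ) ^ 2 * (5 * (d : ℝ) * L * B₀) * c.M * α₀) ∧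
        (∀ (x : Site d) (μ : Fin d), bLoZ L c.a 0 0 ≤ x → x + e μ ≤ bHiZ L c.a c.M 0 0 → c.inTop x → c.inTop (x + e μ) →
          logCovIterZ L (1 : Site d → Fin d → 𝔸ˣ) (iEta η (c.expo η U₀ u)) c.k x μ = mlog ((avgIterZ L (c.axial U₀) c.k x μ : 𝔸ˣ) : 𝔸)) := by
  have hL1 : 1 ≤ L := by omega
  have hLpos : (0 : ℝ) < L := by exact_mod_cast hL1
  have hdpos : (0 : ℝ) < d := by exact_mod_cast (lt_of_lt_of_le (by norm_num) hd2 : 0 < d)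
  obtain ⟨c₁, hc₁, GR⟩ := gaugedBoundB8D_dentedMember_real_γ_mem (𝔸 := 𝔸) τ hτ hd2 hLs hs1 hGrp2 hGrp3 hGA hGH hGu hexpG hB₀ hB₀' hB hC₂ (cB9 := 1 / 2)
    (by norm_num) hB₀'H hB₂' hBG
    hBR hfree hBbd hBd
  -- the allowance of the step datum's exponents is `Kc·(L³α₀ + 6dL²Mα₀) ≤ Kc·7dL²Mα₀`; below `1/(2Kc)` it is `≤ 1/2`, as the `⊗ id` transfer wants
  set Kc : ℝ := 2 * (L * (5 * (d : ℝ) * L * B₀)) + 8 * (8 * B₀' * (5 * (d : ℝ) * L * B₀)) with hKc_def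
  have hKc : 0 < Kc := by positivity
  refine ⟨min c₁ (1 / (2 * Kc)), lt_min hc₁ (by positivity), ?_⟩
  intro η hη K Ω c SC4 U₀ hU₀ α₀ hα hAK hs w hw REAL SC2
  have hLdM : (L : ℝ) ≤ d * c.M := by exact_mod_cast c.L_le_dM
  have hs1 : 7 * d * (L : ℝ) ^ 2 * c.M * α₀ ≤ c₁ := hs.trans (min_le_left _ _)
  have hsK : (L : ℝ) ^ 3 * α₀ + 6 * d * (L : ℝ) ^ 2 * c.M * α₀ ≤ 1 / (2 * Kc) :=
    (smallness_134 hLpos hα hLdM hs).trans (min_le_right _ _)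
  have hcoef : 2 * (L * (5 * (d : ℝ) * L * B₀ * (((L : ℝ) ^ 3 * α₀) + (6 * d * (L : ℝ) ^ 2 * c.M * α₀)))) +
      8 * (8 * B₀' * (5 * (d : ℝ) * L * B₀) * (((L : ℝ) ^ 3 * α₀) + (6 * d * (L : ℝ) ^ 2 * c.M * α₀))) =
      Kc * ((L : ℝ) ^ 3 * α₀ + 6 * d * (L : ℝ) ^ 2 * c.M * α₀) := by rw [hKc_def]; ring
  have hc0 : 0 ≤ 2 * (L * (5 * (d : ℝ) * L * B₀ * (((L : ℝ) ^ 3 * α₀) + (6 * d * (L : ℝ) ^ 2 * c.M * α₀)))) +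
      8 * (8 * B₀' * (5 * (d : ℝ) * L * B₀) * (((L : ℝ) ^ 3 * α₀) + (6 * d * (L : ℝ) ^ 2 * c.M * α₀))) := by
    rw [hcoef]; positivity
  have hchalf : 2 * (L * (5 * (d : ℝ) * L * B₀ * (((L : ℝ) ^ 3 * α₀) + (6 * d * (L : ℝ) ^ 2 * c.M * α₀)))) +
      8 * (8 * B₀' * (5 * (d : ℝ) * L * B₀) * (((L : ℝ) ^ 3 * α₀) + (6 * d * (L : ℝ) ^ 2 * c.M * α₀))) ≤ 1 / 2 := by
    rw [hcoef]
    calc Kc * ((L : ℝ) ^ 3 * α₀ + 6 * d * (L : ℝ) ^ 2 * c.M * α₀) ≤ Kc * (1 / (2 * Kc)) := mul_le_mul_of_nonneg_left hsK hKc.le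
      _ = 1 / 2 := by field_simp
  refine GR η hη c ?_ U₀ hU₀ α₀ hα hAK hs1 w hw REAL ?_
  · -- the flat four-line socket at the cube from the scalar four-line clause (`⊗ id`, this seat's `flat159_clause4_of_scalar_bdryβ`)
    intro α₀' α₂ _ _ hα₂ hα₂c W _ _ _ hLan A' _ hWA hA0
    exact flat159Z_clause4_of_scalar_bdryβ hd2 hLs hη c.k c.sq c.lamS
      (c.lamBPT c.k) hB₀.le hBbd hα₂.le hα₂c SC4 W A' hLan hWA hA0
  · -- `H59Dβ₁` from the scalar two-line γ clause at every truncation (this seat's `flat159_clause_of_scalar_bdryβ`)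
    intro m hm1 hmk u W A' hu huS hW h129 hLan hsa hWA hA0
    exact flat159Z_clause_of_scalar_bdryβ hd2 hLs hη m c.sq (c.lamST m)
      (c.lamBPT m) hB₀.le hBbd hc0 hchalf (SC2 m hm1 hmk) W A' hLan hWA hA0

#print axioms gaugedBoundB8D_dentedMember_scalar_γ_mem


/-! ## §1 (G-edition) `GaugedBoundB8D` at a dented member of the sub-lattice from the scalar γ clauses, the REAL families FED (pure below the top, named at the top) -/

open Classical in
/-- (G-EDITION of the record theorem of the same name without `_mem`: the joint J-SU data `(τ, hτ, G, H, hGrp2, hGrp3, hGA : AvgClosedZ d L G, hGH, hGu, hexpG)` are parameters, `U₀` is `G`-valued instead of unitary, and the conclusion is `Node00.GaugedBoundB8DZ`'s ∃-body SPELLED OUT with `u ∈ G` and `(c.vfix U₀)⁻¹·u ∈ G`; everything else as described next.) ★ **PROPOSITION 6 (p. 99), (1.135)–(1.138) AS `Node00.GaugedBoundB8D` AT A DENTED CUBE MEMBER OF PRINT's BIG-BLOCK SUB-LATTICE, FROM THE TWO SCALAR FLAT γ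
CLAUSES — THE THREE REAL FAMILIES FED BY NAME** — (d3)-11's `gaugedBoundB8D_dentedMember_scalar_γ` with its weights instantiated at print's `wPrinted (d−1) (L−1) η` and its
three REAL inequality families at every truncation `1 ≤ n ≤ k` DISCHARGED: for `n < k` the truncated dented tower `(c.sq ↾ n, c.lamST n)` IS the pure member's
(`CubeB8D.sq_of_lt`, `lamST_of_lt`), and dag-n05-c's UNCONDITIONAL `B8Thm32GBoundCubeMemberHolds.prop6_real123_printed` ((1.91)–(1.92), (1.101), (1.98) on the pure member)
serves letter by letter; for `n = k` the named `Real123DentedCubeMemberPrinted (d−1) (L−1)` (OPEN; [4] Thms 3.1–3.2 on [15]'s `{Ω′_j}`).  Print's p. 98 side conditions on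
the datum (`M_h ≥ 3`, `M₀ ≤ L·M_h`, `M_hL ∣ c.ρ`, `M_hL ∣ c.M`, `R·M_hL ≤ c.ρ`, `2L ≤ R`, `N₀ + 1 ≤ R·L·M_h`, `ρ₀ ≤ c.ρ`) and the dent premise displayed; constants = maxima of
the two sources.  CONDITIONAL on `hR` and on the displayed scalar clauses.
[cite: Balaban1985RegularSpaces, Prop. 6 (1.135)–(1.138) p.99, p.98, Thm 4 p.88, Prop. 3 p.87, (1.59) p.86, (1.31) p.82, (1.91)–(1.92) p.91, (1.98) p.92, (1.101) p.93; Balaban1985Variational, (148)–(152) p.301; Balaban1985BackgroundPropagators, Thm 3.2 (3.48) p.398, Thm 3.1 (3.47) p.398, Thm 3.3 p.399] -/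
theorem gaugedBoundB8D_dentedMember_scalar_γ_of_real123_mem (τ : 𝔸 →L[ℂ] ℂ) (hτ : ∀ x y : 𝔸, τ (x * y) = τ (y * x)) (hd2 : 2 ≤ d) {L sL : ℕ} (hLs : L = 2 * sL + 1)
    (hs1 : 1 ≤ sL)
    {G H : Subgroup 𝔸ˣ} (hGrp2 : ∀ g ∈ H, ‖(g : 𝔸) - 1‖ ≤ 1 / 8 → τ (mlog (g : 𝔸)) = 0) (hGrp3 : ∀ S : 𝔸, τ S = 0 → expUnit S ∈ H)
    (hGA : AvgClosedZ d L G) (hGH : G ≤ H) (hGu : G ≤ unitaryUnits 𝔸)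
    (hexpG : ∀ lam : Site d → 𝔸, (∀ x, IsSelfAdjoint (lam x)) → (∀ x, τ (lam x) = 0) → ∀ x, gaugeExp lam x ∈ G)
    {B₀ Bbd : ℝ} (hB₀ : 0 < B₀)
    (hB : 2 ≤ 5 * (d : ℝ) * L * B₀) (hBbd : 0 ≤ Bbd) (hBd : 4 * Bbd ≤ ((d : ℝ) * L - 1) * B₀) :
    ∃ c₁ ρ₀ M₀ : ℝ, ∃ N₀ : ℕ, 0 < c₁ ∧ ∀ (η : ℝ), 0 < η → ∀ {K : ℕ} {Ω : ℕ → Set (Site d)} (c : CubeB8DZ d L K Ω),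
      -- PRINT'S SIDE CONDITIONS (p. 98) on the cube datum, above threshold: big blocks `M_hL`, `ρ ≥ R·M_hL`, `M_hL ∣ ρ`, `M_hL ∣ M`
      ∀ (Mh R : ℕ), 3 ≤ Mh → M₀ ≤ (L : ℝ) * Mh → Mh * L ∣ c.ρ → Mh * L ∣ c.M → R * (Mh * L) ≤ c.ρ → 2 * L ≤ R →
        N₀ + 1 ≤ R * (L * Mh) → ρ₀ ≤ (c.ρ : ℝ) →
      -- THE DENT PREMISE ([6] (1.4)₂): `Ω_k` is a union of cubes of side `M_hL^{k+1}` of the grid anchored at `□_k`'s fine lower corner `Lᵏ(c.a − c.ρ)`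
      (∀ x y : Site d,
          blockMap (Mh * L ^ (c.k + 1)) (x - fun i => (L : ℤ) ^ c.k * (c.a i - c.ρ) - (ctrShift L c.k : ℤ)) =
            blockMap (Mh * L ^ (c.k + 1)) (y - fun i => (L : ℤ) ^ c.k * (c.a i - c.ρ) - (ctrShift L c.k : ℤ)) → x ∈ Ω c.k → y ∈ Ω c.k) →
      -- THE SCALAR FLAT FOUR-LINE (1.59) CLAUSE OF PROPOSITION 3's FRAME at the cube's top truncation `c.k`: ℂ-valued bond functions in the
      -- flat Landau gauge on the collars of `{□_j}`, exterior-collar allowance on each line ([4] Thm 3.3 at `U = 1` for `G(1)`, `H(1)`, a priori)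
      (∀ φ : Site d → Fin d → ℂ,
        IsLandau138Z L c.k η (c.sq 0) c.lamS (1 : Site d → Fin d → ℂˣ) φ →
        (∀ (y : Site d) (τ : Fin d), (∀ j, j ≤ c.k → ¬ SideTouches (c.sq j) y τ) → φ y τ = 0) →
        msup L c.k η (-(1 : ℝ)) (fun j (b : Site d × Fin d) => SideTouches (c.sq j) b.1 b.2) (fun b => φ b.1 b.2)
          ≤ B₀ * (bondNorm L c.k η (-(3 : ℝ)) c.sq (fun x μ => Jcur η (1 : Site d → Fin d → ℂˣ) φ μ x)
            + wsup 1 (fun p : {p : ℕ × (Site d × Fin d) // p.1 ≤ c.k ∧ (p.2 ∈ c.lamBPT c.k p.1 ∨ (p.1 = 0 ∧ CrossB (c.sq 0) p.2))} =>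
                linCovIterZ L (1 : Site d → Fin d → ℂˣ) (iEta η φ) p.1.1 p.1.2.1 p.1.2.2))
            + Bbd * msup L c.k η (-(1 : ℝ)) (fun j (b : Site d × Fin d) => j = 0 ∧ SideTouches (c.sq 0) b.1 b.2 ∧
                ¬ BondTouches (c.sq 0) b.1 b.2) (fun b => φ b.1 b.2) ∧
        msup L c.k η (-(2 : ℝ)) (fun j (t : Fin d × Fin d × Site d) => SideTouches (c.sq j) t.2.2 t.2.1)
            (fun t => covDerivFwd η (1 : Site d → Fin d → ℂˣ) t.1 (fun z => φ z t.2.1) t.2.2)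
          ≤ B₀ * (bondNorm L c.k η (-(3 : ℝ)) c.sq (fun x μ => Jcur η (1 : Site d → Fin d → ℂˣ) φ μ x)
            + wsup 1 (fun p : {p : ℕ × (Site d × Fin d) // p.1 ≤ c.k ∧ (p.2 ∈ c.lamBPT c.k p.1 ∨ (p.1 = 0 ∧ CrossB (c.sq 0) p.2))} =>
                linCovIterZ L (1 : Site d → Fin d → ℂˣ) (iEta η φ) p.1.1 p.1.2.1 p.1.2.2))
            + Bbd * msup L c.k η (-(1 : ℝ)) (fun j (b : Site d × Fin d) => j = 0 ∧ SideTouches (c.sq 0) b.1 b.2 ∧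
                ¬ BondTouches (c.sq 0) b.1 b.2) (fun b => φ b.1 b.2) ∧
        bondNorm L c.k η (-(3 : ℝ)) c.sq (fun x μ => pdiv η (1 : Site d → Fin d → ℂˣ) (plaqCovDeriv η (1 : Site d → Fin d → ℂˣ) φ) μ x)
          ≤ B₀ * (bondNorm L c.k η (-(3 : ℝ)) c.sq (fun x μ => Jcur η (1 : Site d → Fin d → ℂˣ) φ μ x)
            + wsup 1 (fun p : {p : ℕ × (Site d × Fin d) // p.1 ≤ c.k ∧ (p.2 ∈ c.lamBPT c.k p.1 ∨ (p.1 = 0 ∧ CrossB (c.sq 0) p.2))} =>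
                linCovIterZ L (1 : Site d → Fin d → ℂˣ) (iEta η φ) p.1.1 p.1.2.1 p.1.2.2))
            + Bbd * msup L c.k η (-(1 : ℝ)) (fun j (b : Site d × Fin d) => j = 0 ∧ SideTouches (c.sq 0) b.1 b.2 ∧
                ¬ BondTouches (c.sq 0) b.1 b.2) (fun b => φ b.1 b.2) ∧
        bondNorm L c.k η (-(3 : ℝ)) c.sq (fun x μ => covLap η (1 : Site d → Fin d → ℂˣ) (fun z => φ z μ) x)
          ≤ B₀ * (bondNorm L c.k η (-(3 : ℝ)) c.sq (fun x μ => Jcur η (1 : Site d → Fin d → ℂˣ) φ μ x)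
            + wsup 1 (fun p : {p : ℕ × (Site d × Fin d) // p.1 ≤ c.k ∧ (p.2 ∈ c.lamBPT c.k p.1 ∨ (p.1 = 0 ∧ CrossB (c.sq 0) p.2))} =>
                linCovIterZ L (1 : Site d → Fin d → ℂˣ) (iEta η φ) p.1.1 p.1.2.1 p.1.2.2))
            + Bbd * msup L c.k η (-(1 : ℝ)) (fun j (b : Site d × Fin d) => j = 0 ∧ SideTouches (c.sq 0) b.1 b.2 ∧
                ¬ BondTouches (c.sq 0) b.1 b.2) (fun b => φ b.1 b.2)) →
      ∀ (U₀ : Site d → Fin d → 𝔸ˣ), (∀ x κ, U₀ x κ ∈ G) → ∀ (α₀ : ℝ), 0 < α₀ → InAk L K η α₀ Ω U₀ →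
      7 * d * (L : ℝ) ^ 2 * c.M * α₀ ≤ c₁ →
      -- THE SCALAR FLAT TWO-LINE (1.59) CLAUSE OF THEOREM 4's FRAME at every truncation `m ≤ c.k` (ℂ-valued, flat Landau gauge, collar allowance)
      (∀ m, 1 ≤ m → m ≤ c.k → ∀ φ : Site d → Fin d → ℂ,
        IsLandau138Z L m η (c.sq 0) (c.lamST m) (1 : Site d → Fin d → ℂˣ) φ →
        (∀ (y : Site d) (τ : Fin d), (∀ j, j ≤ m → ¬ SideTouches (c.sq j) y τ) → φ y τ = 0) →
        msup L m η (-(1 : ℝ)) (fun j (b : Site d × Fin d) => SideTouches (c.sq j) b.1 b.2) (fun b => φ b.1 b.2)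
          ≤ B₀ * (bondNorm L m η (-(3 : ℝ)) c.sq (fun x μ => Jcur η (1 : Site d → Fin d → ℂˣ) φ μ x)
            + wsup 1 (fun p : {p : ℕ × (Site d × Fin d) // p.1 ≤ m ∧ (p.2 ∈ c.lamBPT m p.1 ∨ (p.1 = 0 ∧ CrossB (c.sq 0) p.2))} =>
                linCovIterZ L (1 : Site d → Fin d → ℂˣ) (iEta η φ) p.1.1 p.1.2.1 p.1.2.2))
            + Bbd * msup L m η (-(1 : ℝ)) (fun j (b : Site d × Fin d) => j = 0 ∧ SideTouches (c.sq 0) b.1 b.2 ∧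
                ¬ BondTouches (c.sq 0) b.1 b.2) (fun b => φ b.1 b.2) ∧
        msup L m η (-(2 : ℝ)) (fun j (t : Fin d × Fin d × Site d) => SideTouches (c.sq j) t.2.2 t.2.1)
            (fun t => covDerivFwd η (1 : Site d → Fin d → ℂˣ) t.1 (fun z => φ z t.2.1) t.2.2)
          ≤ B₀ * (bondNorm L m η (-(3 : ℝ)) c.sq (fun x μ => Jcur η (1 : Site d → Fin d → ℂˣ) φ μ x)
            + wsup 1 (fun p : {p : ℕ × (Site d × Fin d) // p.1 ≤ m ∧ (p.2 ∈ c.lamBPT m p.1 ∨ (p.1 = 0 ∧ CrossB (c.sq 0) p.2))} =>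
                linCovIterZ L (1 : Site d → Fin d → ℂˣ) (iEta η φ) p.1.1 p.1.2.1 p.1.2.2))
            + Bbd * msup L m η (-(1 : ℝ)) (fun j (b : Site d × Fin d) => j = 0 ∧ SideTouches (c.sq 0) b.1 b.2 ∧
                ¬ BondTouches (c.sq 0) b.1 b.2) (fun b => φ b.1 b.2)) →
      ∃ u : Site d → 𝔸ˣ, (∀ x, u x ∈ G) ∧ (∀ x, x ∉ c.sq 0 → u x = 1) ∧
        Restr129Z L c.k c.lamS (1 : Site d → Fin d → 𝔸ˣ) u ∧
        IsLandau138WZ L c.k η (c.sq 0) c.lamS (1 : Site d → Fin d → 𝔸ˣ) (c.fixed U₀ u) ∧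
        (∀ j, j ≤ c.k → ∀ b ∈ {b : Site d × Fin d | SideTouches (c.sq j) b.1 b.2},
          c.fixed U₀ u b.1 b.2 = cfgExp η (logCfg η (c.fixed U₀ u)) b.1 b.2 ∧ IsSelfAdjoint (logCfg η (c.fixed U₀ u) b.1 b.2) ∧
            ‖logCfg η (c.fixed U₀ u) b.1 b.2‖ ≤ (7 * d * (L : ℝ) ^ 2 * (5 * (d : ℝ) * L * B₀) * c.M * α₀) * ((L : ℝ) ^ j * η)⁻¹) ∧
        (∀ x, ((c.vfix U₀)⁻¹ * u) x ∈ G) ∧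
        AgreeOn (tlo L (tLo c.a c.ρ) c.k) (thi L (tHi c.a c.M c.ρ) c.k) (gaugeAct ((c.vfix U₀)⁻¹ * u)⁻¹ U₀) (c.fixed U₀ u) ∧
        msup L c.k η (-(2 : ℝ)) (fun j (t : Fin d × Fin d × Site d) => SideTouches (c.sq j) t.2.2 t.2.1)
            (fun t => covDerivFwd η (1 : Site d → Fin d → 𝔸ˣ) t.1 (fun z => c.expo η U₀ u z t.2.1) t.2.2) ≤ (7 * d * (L : ℝ) ^ 2 * (5 * (d : ℝ) * L * B₀) * c.M * α₀) ∧
        bondNorm L c.k η (-(3 : ℝ)) c.sq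
            (fun x μ => pdiv η (1 : Site d → Fin d → 𝔸ˣ) (plaqCovDeriv η (1 : Site d → Fin d → 𝔸ˣ) (c.expo η U₀ u)) μ x) ≤ (7 * d * (L : ℝ) ^ 2 * (5 * (d : ℝ) * L * B₀) * c.M * α₀) ∧
        bondNorm L c.k η (-(3 : ℝ)) c.sq (fun x μ => covLap η (1 : Site d → Fin d → 𝔸ˣ) (fun z => c.expo η U₀ u z μ) x) ≤ (7 * d * (L : ℝ) ^ 2 * (5 * (d : ℝ) * L * B₀) * c.M * α₀) ∧
        (∀ (x : Site d) (μ : Fin d), bLoZ L c.a 0 0 ≤ x → x + e μ ≤ bHiZ L c.a c.M 0 0 → c.inTop x → c.inTop (x + e μ) →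
          logCovIterZ L (1 : Site d → Fin d → 𝔸ˣ) (iEta η (c.expo η U₀ u)) c.k x μ = mlog ((avgIterZ L (c.axial U₀) c.k x μ : 𝔸ˣ) : 𝔸)) := by
  -- write `d = d' + 1`, `L = ℓ + 1` (dag-n05-c's convention)
  obtain ⟨d', rfl⟩ : ∃ d', d = d' + 1 := ⟨d - 1, by omega⟩
  obtain ⟨ℓ, rfl⟩ : ∃ ℓ, L = ℓ + 1 := ⟨L - 1, by omega⟩
  have hℓ : 1 ≤ ℓ := by omega
  have hodd : Odd (ℓ + 1) := ⟨sL, by omega⟩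
  -- the PURE real families (dag-n05-c, unconditional) and the DENTED ones at the top (named)
  obtain ⟨BGp, BHp, B2p, BRp, ρ₁, M₁, N₁, hBGp, hBHp, hB2p, hBRp, -, -, RP⟩ := prop6_real123_printedZ d' ℓ hℓ hodd
  have hR' : Real123DentedCubeMemberPrintedZ d' ℓ := real123DentedCubeMemberPrintedZ_holds d' ℓ hℓ hodd
  obtain ⟨BGd, BHd, B2d, BRd, ρ₂, M₂, N₂, -, -, -, -, RD⟩ := hR'
  -- (d3)-11's constants: maxima of the two sources
  have hBG : 0 < max BGp BGd := lt_max_of_lt_left hBGp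
  have hBH : 0 < max BHp BHd := lt_max_of_lt_left hBHp
  have hB2 : 0 ≤ max B2p B2d := le_max_of_le_left hB2p
  have hBR : 0 ≤ max BRp BRd := le_max_of_le_left hBRp
  have hB₀' : 0 < 3 * (2 * ((d' + 1 : ℕ) : ℝ) * (((ℓ + 1 : ℕ) : ℝ)) ^ 2) * max BGp BGd * max BRp BRd + 1 := by positivity
  have hfree : 3 * (2 * ((d' + 1 : ℕ) : ℝ) * (((ℓ + 1 : ℕ) : ℝ)) ^ 2) * max BGp BGd * max BRp BRd ≤
      3 * (2 * ((d' + 1 : ℕ) : ℝ) * (((ℓ + 1 : ℕ) : ℝ)) ^ 2) * max BGp BGd * max BRp BRd + 1 := by linarith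
  have hC₂ : 2 * ((1 + 2 * gZ (d' + 1) (ℓ + 1)) * (2 * (131072 * (((d' + 1 : ℕ) : ℝ) + 1) ^ 2) * (KZ (d' + 1) (ℓ + 1)) ^ 2)) * (((ℓ + 1 : ℕ) : ℝ)) ^ 2 ≤
      2 * ((1 + 2 * gZ (d' + 1) (ℓ + 1)) * (2 * (131072 * (((d' + 1 : ℕ) : ℝ) + 1) ^ 2) * (KZ (d' + 1) (ℓ + 1)) ^ 2)) * (((ℓ + 1 : ℕ) : ℝ)) ^ 2 :=
    le_rfl
  obtain ⟨c₁, hc₁, GR⟩ := gaugedBoundB8D_dentedMember_scalar_γ_mem (𝔸 := 𝔸) τ hτ hd2 hLs hs1 hGrp2 hGrp3 hGA hGH hGu hexpG hB₀ hB₀' hB hC₂ hBH hB2 hBG.le hBR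
    hfree hBbd hBd
  refine ⟨c₁, max ρ₁ ρ₂, max M₁ M₂, max N₁ N₂, hc₁, ?_⟩
  intro η hη K Ω c Mh R hMh hM0 hρd hMd hRρ hR2 hRN hρ0 hΩ SC4 U₀ hU₀ α₀ hα hAK hs SC2
  refine GR η hη c SC4 U₀ hU₀ α₀ hα hAK hs (wPrinted d' ℓ η) (fun j => ((wPrinted_facts d' hℓ hη).1 j).le) ?_ SC2
  -- the REAL block of (d3)-11 at `w := wPrinted`
  intro n hn hnk
  unfold Real123Block
  intro S hS B hB Kf hKf T hT Q hQ
  have hρpos : 0 < c.ρ := lt_of_lt_of_le (by omega) c.L_le_ρ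
  have hM0' : max M₁ M₂ ≤ ((ℓ : ℝ) + 1) * Mh := by
    have : ((ℓ + 1 : ℕ) : ℝ) = (ℓ : ℝ) + 1 := by push_cast; ring
    rw [← this]; exact hM0
  have hM₁ : M₁ ≤ ((ℓ : ℝ) + 1) * Mh := (le_max_left _ _).trans hM0'
  have hM₂ : M₂ ≤ ((ℓ : ℝ) + 1) * Mh := (le_max_right _ _).trans hM0'
  have hN₁ : N₁ + 1 ≤ R * ((ℓ + 1) * Mh) := le_trans (Nat.succ_le_succ (le_max_left _ _)) hRN
  have hN₂ : N₂ + 1 ≤ R * ((ℓ + 1) * Mh) := le_trans (Nat.succ_le_succ (le_max_right _ _)) hRN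
  have hρ₁ : ρ₁ ≤ (c.ρ : ℝ) := (le_max_left _ _).trans hρ0
  have hρ₂ : ρ₂ ≤ (c.ρ : ℝ) := (le_max_right _ _).trans hρ0
  rcases lt_or_eq_of_le hnk with hlt | heq
  · -- `n < k`: the truncated dented tower is the PURE member's — dag-n05-c's theorem, letter by letter
    have hsqj : ∀ j, j ≤ n → c.sq j = cubeFamZ false (ℓ + 1) c.a c.M c.ρ c.k j := fun j hj => by
      rw [c.sq_of_lt (lt_of_le_of_lt hj hlt), cubeFam_false_of_le (ℓ + 1) c.a c.M c.ρ (hj.trans hnk)]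
    have hsq0 := hsqj 0 (Nat.zero_le n)
    rw [hsq0] at hS
    rw [lamST_of_lt c hlt] at hB hKf
    obtain ⟨P1, P2, P3⟩ := RP η hη Mh hMh hM₁ c.a c.M c.ρ c.k n R hn hnk hρd hMd hρpos hRρ hR2 hN₁ hρ₁ S hS B hB Kf hKf T hT Q hQ
    refine ⟨fun ρ' r hr hρ' φ hφ0 hφS => ?_, fun X s hs0 hXs φ hφ0 hφS => ?_, fun ρ' r hr hρ' j hj v hv => ?_⟩
    · obtain ⟨a1, a2⟩ := P1 ρ' r hr (fun j hj z hz => hρ' j hj z (by rw [hsqj j hj]; exact hz)) φ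
        (fun x hx => hφ0 x (by rw [hsq0]; exact hx)) hφS
      exact ⟨fun x => (a1 x).trans (mul_le_mul_of_nonneg_right (le_max_left _ _) hr),
        fun j hj p hp => (a2 j hj p (by rw [← hsqj j hj]; exact hp)).trans (mul_le_mul_of_nonneg_right (le_max_left _ _) hr)⟩
    · obtain ⟨f, g, Δ⟩ := P2 X s hs0 hXs φ (fun x hx => hφ0 x (by rw [hsq0]; exact hx)) hφS
      exact ⟨fun x => (f x).trans (mul_le_mul_of_nonneg_right (le_max_left _ _) hs0),
        fun j hj p hp => (g j hj p (by rw [← hsqj j hj]; exact hp)).trans (mul_le_mul_of_nonneg_right (le_max_left _ _) hs0),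
        fun j hj x hx => (Δ j hj x (by rw [← hsqj j hj]; exact hx)).trans (mul_le_mul_of_nonneg_right (le_max_left _ _) hs0)⟩
    · exact (P3 ρ' r hr (fun j' hj' z hz => hρ' j' hj' z (by rw [hsqj j' hj']; exact hz)) j hj v
        (by rw [← hsqj j hj]; exact hv)).trans (mul_le_mul_of_nonneg_right (le_max_left _ _) hr)
  · -- `n = k`: the DENTED named fact verbatim (cells `c.lamS = c.lamST c.k`)
    subst heq
    have hTop : c.lamST c.k = c.lamS := funext (lamST_top_apply c)
    rw [hTop] at hB hKf
    obtain ⟨P1, P2, P3⟩ := RD η hη Mh hMh hM₂ _ _ c R hρd hMd hRρ hR2 hN₂ hρ₂ hΩ S hS B hB Kf hKf T hT Q hQ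
    refine ⟨fun ρ' r hr hρ' φ hφ0 hφS => ?_, fun X s hs0 hXs φ hφ0 hφS => ?_, fun ρ' r hr hρ' j hj v hv => ?_⟩
    · obtain ⟨a1, a2⟩ := P1 ρ' r hr hρ' φ hφ0 hφS
      exact ⟨fun x => (a1 x).trans (mul_le_mul_of_nonneg_right (le_max_right _ _) hr),
        fun j hj p hp => (a2 j hj p hp).trans (mul_le_mul_of_nonneg_right (le_max_right _ _) hr)⟩
    · obtain ⟨f, g, Δ⟩ := P2 X s hs0 hXs φ hφ0 hφS
      exact ⟨fun x => (f x).trans (mul_le_mul_of_nonneg_right (le_max_right _ _) hs0),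
        fun j hj p hp => (g j hj p hp).trans (mul_le_mul_of_nonneg_right (le_max_right _ _) hs0),
        fun j hj x hx => (Δ j hj x hx).trans (mul_le_mul_of_nonneg_right (le_max_right _ _) hs0)⟩
    · exact (P3 ρ' r hr hρ' j hj v hv).trans (mul_le_mul_of_nonneg_right (le_max_right _ _) hr)

/-! ## §2 The crown: `GaugedBoundB8D` at a dented member of the sub-lattice from the THREE NAMED FACTS -/

open Classical in
/-- (G-EDITION of the record theorem of the same name without `_mem`: the joint J-SU data `(τ, hτ, G, H, hGrp2, hGrp3, hGA : AvgClosedZ d L G, hGH, hGu, hexpG)` are parameters, `U₀` is `G`-valued instead of unitary, and the conclusion is `Node00.GaugedBoundB8DZ`'s ∃-body SPELLED OUT with `u ∈ G` and `(c.vfix U₀)⁻¹·u ∈ G`; everything else as described next.) ★★ **PROPOSITION 6 (p. 99), (1.135)–(1.138) AS `Node00.GaugedBoundB8D` AT EVERY DENTED CUBE MEMBER OF PRINT's BIG-BLOCK SUB-LATTICE, FROM THE NAMED FLAT FACTS.**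
There are `B₀ ≥ 1`, `c₁ > 0` and thresholds `ρ₀, M₀, N₀, R₀` such that for every `η > 0`, every dented cube datum `c : CubeB8D d L K Ω` ([15] (148)–(150)) on print's
p. 98 sub-lattice above threshold (`M_h = Lˢ ≥ 3`, `M₀ ≤ L^{s+1}`, `L^{s+1} ∣ ρ`, `L^{s+1} ∣ M`, `R·L^{s+1} ≤ ρ`, `2L ≤ R`, `R₀ ≤ R`, `N₀ + 1 ≤ R·L^{s+1}`, `ρ₀ ≤ ρ`) whose
ambient top member `Ω_k` is a union of `L^{s+1}Lᵏ`-cubes of the grid anchored at `□_k`'s corner ((1.4)₂), every unitary `U₀ ∈ 𝔄_K({Ω_j}, α₀)` with `7dL²Mα₀ ≤ c₁`: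
`GaugedBoundB8D L η U₀ c (7dL²·5dLB₀·Mα₀)` — Proposition 6's gauge `u` on `□̃`, the Landau gauge (1.138) at background `1` over the dented tower `{Ω′_j}`, (1.136)₁–₄
with print's constant shape.  HYPOTHESES (three named facts): the pure `h159 : Ineq159FlatCubeMemberPrinted d L` ((1.59) at `U₀ = 1` on the pure member — PROVED in the
tree for odd `L ≥ 5`, see §3), the dented `h159D : Ineq159FlatDentedCubeMemberPrinted d L` (top truncation of `{Ω′_j}`; OPEN) and `hR : Real123DentedCubeMemberPrinted
(d−1) (L−1)` ((1.91)–(1.92), (1.98), (1.101) at the top truncation of `{Ω′_j}`; OPEN); window `5 ≤ d·L`.  Composition: `sc4_dented_of_ineq159Printed` at the datum with the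
flat line's split index (`lamBPF_sub_splitIndex`; SC4γ at `m = k`, the first two lines at every `1 ≤ m ≤ k`) into §1 at `M_h := Lˢ`.
[cite: Balaban1985RegularSpaces, Prop. 6 (1.135)–(1.138) p.99, p.98, Thm 4 p.88, Prop. 3 p.87, (1.59) p.86, (1.62) p.87, (1.31) p.82, (1.91)–(1.92) p.91, (1.98) p.92, (1.101) p.93, (1.4) p.77; Balaban1985Variational, (148)–(152) p.301, p.300; Balaban1985BackgroundPropagators, Thm 3.3 p.399, Thm 3.2 (3.48) p.398, Thm 3.1 (3.47) p.398; Balaban1984PropagatorsII, Prop. 2.6 (2.136) p.247, Prop. 2.3 (2.87) p.238] -/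
theorem gaugedBoundB8D_dentedMember_scalar_γ_of_namedFacts_mem (τ : 𝔸 →L[ℂ] ℂ) (hτ : ∀ x y : 𝔸, τ (x * y) = τ (y * x)) (hd2 : 2 ≤ d) {L sL : ℕ} (hLs : L = 2 * sL + 1)
    (hs1 : 1 ≤ sL)
    {G H : Subgroup 𝔸ˣ} (hGrp2 : ∀ g ∈ H, ‖(g : 𝔸) - 1‖ ≤ 1 / 8 → τ (mlog (g : 𝔸)) = 0) (hGrp3 : ∀ S : 𝔸, τ S = 0 → expUnit S ∈ H)
    (hGA : AvgClosedZ d L G) (hGH : G ≤ H) (hGu : G ≤ unitaryUnits 𝔸)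
    (hexpG : ∀ lam : Site d → 𝔸, (∀ x, IsSelfAdjoint (lam x)) → (∀ x, τ (lam x) = 0) → ∀ x, gaugeExp lam x ∈ G)
    (hdL : 5 ≤ d * L)
    (h159 : Ineq159FlatCubeMemberCovPrintedZ d L) (h159D : Ineq159FlatDentedCubeMemberCovPrintedZ d L) :
    ∃ B₀ c₁ ρ₀ M₀ : ℝ, ∃ N₀ R₀ : ℕ, 1 ≤ B₀ ∧ 0 < c₁ ∧ ∀ (η : ℝ), 0 < η → ∀ {K : ℕ} {Ω : ℕ → Set (Site d)} (c : CubeB8DZ d L K Ω),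
      -- PRINT'S SIDE CONDITIONS (p. 98) on the cube datum in the named facts' letters (`M_h = Lˢ`), above threshold
      ∀ (s R : ℕ), 3 ≤ L ^ s → M₀ ≤ (L : ℝ) ^ (s + 1) → L ^ (s + 1) ∣ c.ρ → L ^ (s + 1) ∣ c.M → R * L ^ (s + 1) ≤ c.ρ → 2 * L ≤ R →
        R₀ ≤ R → N₀ + 1 ≤ R * L ^ (s + 1) → ρ₀ ≤ (c.ρ : ℝ) →
      -- THE DENT PREMISE ([6] (1.4)₂): `Ω_k` is a union of cubes of side `L^{s+1}Lᵏ` of the grid anchored at `□_k`'s fine lower corner `Lᵏ(c.a − c.ρ)`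
      (∀ x y : Site d,
          blockMap (L ^ (s + 1) * L ^ c.k) (x - fun i => (L : ℤ) ^ c.k * (c.a i - c.ρ) - (ctrShift L c.k : ℤ)) =
            blockMap (L ^ (s + 1) * L ^ c.k) (y - fun i => (L : ℤ) ^ c.k * (c.a i - c.ρ) - (ctrShift L c.k : ℤ)) → x ∈ Ω c.k → y ∈ Ω c.k) →
      ∀ (U₀ : Site d → Fin d → 𝔸ˣ), (∀ x κ, U₀ x κ ∈ G) → ∀ (α₀ : ℝ), 0 < α₀ → InAk L K η α₀ Ω U₀ →
      7 * d * (L : ℝ) ^ 2 * c.M * α₀ ≤ c₁ →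
      ∃ u : Site d → 𝔸ˣ, (∀ x, u x ∈ G) ∧ (∀ x, x ∉ c.sq 0 → u x = 1) ∧
        Restr129Z L c.k c.lamS (1 : Site d → Fin d → 𝔸ˣ) u ∧
        IsLandau138WZ L c.k η (c.sq 0) c.lamS (1 : Site d → Fin d → 𝔸ˣ) (c.fixed U₀ u) ∧
        (∀ j, j ≤ c.k → ∀ b ∈ {b : Site d × Fin d | SideTouches (c.sq j) b.1 b.2},
          c.fixed U₀ u b.1 b.2 = cfgExp η (logCfg η (c.fixed U₀ u)) b.1 b.2 ∧ IsSelfAdjoint (logCfg η (c.fixed U₀ u) b.1 b.2) ∧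
            ‖logCfg η (c.fixed U₀ u) b.1 b.2‖ ≤ (7 * d * (L : ℝ) ^ 2 * (5 * (d : ℝ) * L * B₀) * c.M * α₀) * ((L : ℝ) ^ j * η)⁻¹) ∧
        (∀ x, ((c.vfix U₀)⁻¹ * u) x ∈ G) ∧
        AgreeOn (tlo L (tLo c.a c.ρ) c.k) (thi L (tHi c.a c.M c.ρ) c.k) (gaugeAct ((c.vfix U₀)⁻¹ * u)⁻¹ U₀) (c.fixed U₀ u) ∧
        msup L c.k η (-(2 : ℝ)) (fun j (t : Fin d × Fin d × Site d) => SideTouches (c.sq j) t.2.2 t.2.1)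
            (fun t => covDerivFwd η (1 : Site d → Fin d → 𝔸ˣ) t.1 (fun z => c.expo η U₀ u z t.2.1) t.2.2) ≤ (7 * d * (L : ℝ) ^ 2 * (5 * (d : ℝ) * L * B₀) * c.M * α₀) ∧
        bondNorm L c.k η (-(3 : ℝ)) c.sq
            (fun x μ => pdiv η (1 : Site d → Fin d → 𝔸ˣ) (plaqCovDeriv η (1 : Site d → Fin d → 𝔸ˣ) (c.expo η U₀ u)) μ x) ≤ (7 * d * (L : ℝ) ^ 2 * (5 * (d : ℝ) * L * B₀) * c.M * α₀) ∧
        bondNorm L c.k η (-(3 : ℝ)) c.sq (fun x μ => covLap η (1 : Site d → Fin d → 𝔸ˣ) (fun z => c.expo η U₀ u z μ) x) ≤ (7 * d * (L : ℝ) ^ 2 * (5 * (d : ℝ) * L * B₀) * c.M * α₀) ∧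
        (∀ (x : Site d) (μ : Fin d), bLoZ L c.a 0 0 ≤ x → x + e μ ≤ bHiZ L c.a c.M 0 0 → c.inTop x → c.inTop (x + e μ) →
          logCovIterZ L (1 : Site d → Fin d → 𝔸ˣ) (iEta η (c.expo η U₀ u)) c.k x μ = mlog ((avgIterZ L (c.axial U₀) c.k x μ : 𝔸ˣ) : 𝔸)) := by
  have hL1 : 1 ≤ L := by omega
  have hL : 2 ≤ L := by omega
  obtain ⟨B₀, ρ₀, M₀, N₀, R₀, hB₀, SC⟩ := sc4_dented_of_ineq159Printed hd2 hLs h159 h159D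
  have hB₀pos : 0 < B₀ := lt_of_lt_of_le one_pos hB₀
  have hdr : (2 : ℝ) ≤ d := by exact_mod_cast hd2
  have hLr : (2 : ℝ) ≤ L := by exact_mod_cast hL
  have hdLr : (5 : ℝ) ≤ (d : ℝ) * L := by exact_mod_cast hdL
  have hB : 2 ≤ 5 * (d : ℝ) * L * B₀ := by nlinarith [hB₀, hdr, hLr]
  have hBd : 4 * B₀ ≤ ((d : ℝ) * L - 1) * B₀ := by nlinarith [hB₀, hdLr]
  obtain ⟨c₁, ρ₁, M₁, N₁, hc₁, P6⟩ := gaugedBoundB8D_dentedMember_scalar_γ_of_real123_mem (𝔸 := 𝔸) τ hτ hd2 hLs hs1 hGrp2 hGrp3 hGA hGH hGu hexpG hB₀pos hB hB₀pos.le hBd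
  refine ⟨B₀, c₁, max ρ₀ ρ₁, max M₀ M₁, max N₀ N₁, R₀, hB₀, hc₁, ?_⟩
  intro η hη K Ω c s R hMh hM₀ hdρ hdM hRρ h2L hR₀ hN₀ hρ₀ hΩ U₀ hU₀ α₀ hα hA hs
  have hk : 1 ≤ c.k := c.one_le_k
  -- print's side conditions in §1's letters (`M_h := Lˢ`)
  have hMhL : L ^ s * L = L ^ (s + 1) := (pow_succ L s).symm
  have hLMh : L * L ^ s = L ^ (s + 1) := by rw [mul_comm]; exact hMhL
  have hM₁ : M₁ ≤ (L : ℝ) * (L ^ s : ℕ) := by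
    have : ((L : ℝ) * (L ^ s : ℕ)) = (L : ℝ) ^ (s + 1) := by push_cast; ring
    rw [this]; exact (le_max_right _ _).trans hM₀
  have hM₀' : M₀ ≤ (L : ℝ) ^ (s + 1) := (le_max_left _ _).trans hM₀
  have hN₁ : N₁ + 1 ≤ R * (L * L ^ s) := by rw [hLMh]; exact le_trans (Nat.succ_le_succ (le_max_right _ _)) hN₀
  have hN₀' : N₀ + 1 ≤ R * L ^ (s + 1) := le_trans (Nat.succ_le_succ (le_max_left _ _)) hN₀
  have hρ₁ : ρ₁ ≤ (c.ρ : ℝ) := (le_max_right _ _).trans hρ₀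
  have hρ₀' : ρ₀ ≤ (c.ρ : ℝ) := (le_max_left _ _).trans hρ₀
  -- the dent premise in §1's letters (`Lˢ·L^{k+1} = L^{s+1}·Lᵏ`)
  have hpow : L ^ s * L ^ (c.k + 1) = L ^ (s + 1) * L ^ c.k := by ring
  have hΩ' : ∀ x y : Site d, blockMap (L ^ s * L ^ (c.k + 1)) (x - fun i => (L : ℤ) ^ c.k * (c.a i - c.ρ) - (ctrShift L c.k : ℤ)) =
      blockMap (L ^ s * L ^ (c.k + 1)) (y - fun i => (L : ℤ) ^ c.k * (c.a i - c.ρ) - (ctrShift L c.k : ℤ)) → x ∈ Ω c.k → y ∈ Ω c.k := by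
    rw [hpow]; exact hΩ
  -- the SCALAR γ clauses at this datum from the two named facts, in the flat line's split index
  have S := fun m (hm1 : 1 ≤ m) (hmk : m ≤ c.k) =>
    SC η hη c s R hM₀' hdρ hdM hRρ hR₀ hN₀' hρ₀' hΩ m hm1 hmk
      (fun j b => b ∈ c.lamBPT m j ∨ (j = 0 ∧ CrossB (c.sq 0) b)) (lamBPF_sub_splitIndex c hLs hm1 hmk)
  exact P6 η hη c (L ^ s) R hMh hM₁ (by rw [hMhL]; exact hdρ) (by rw [hMhL]; exact hdM) (by rw [hMhL]; exact hRρ) h2L hN₁ hρ₁ hΩ'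
    (fun φ hLan hsupp => S c.k hk le_rfl φ (by rw [show c.lamST c.k = c.lamS from funext (lamST_top_apply c)]; exact hLan) hsupp) U₀ hU₀ α₀ hα hA hs
    (fun m hm1 hmk φ hLan hsupp => ⟨(S m hm1 hmk φ hLan hsupp).1, (S m hm1 hmk φ hLan hsupp).2.1⟩)

/-! ## §3 THE RECORD CROWN: `GaugedBoundB8DZ` at every dented centred member of the sub-lattice, odd `L ≥ 5`, `d ≥ 2` — MODULO THE TWO PRINTED NAMED FACTS OF RECORD -/

open Classical in
/-- (G-EDITION of the record theorem of the same name without `_mem`: the joint J-SU data `(τ, hτ, G, H, hGrp2, hGrp3, hGA : AvgClosedZ d L G, hGH, hGu, hexpG)` are parameters, `U₀` is `G`-valued instead of unitary, and the conclusion is `Node00.GaugedBoundB8DZ`'s ∃-body SPELLED OUT with `u ∈ G` and `(c.vfix U₀)⁻¹·u ∈ G`; everything else as described next.) ★★★ **PROPOSITION 6 (p. 99), (1.135)–(1.138) AS `Node00.GaugedBoundB8DZ` AT EVERY DENTED CENTRED CUBE MEMBER OF PRINT's BIG-BLOCK SUB-LATTICE, FOR ODD `L = 2s+1 ≥ 5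`
AND `d ≥ 2` — THE RECORD CROWN OF «N05-REC» R6, MODULO EXACTLY TWO PRINTED NAMED FACTS** ([4] Thm 3.3 ∕ [6] (1.59), (1.62) at `U₀ = 1` for the record's linearised averaging
`Q_j(1)` = [4] (3.14)–(3.15), on the pure and on the dented centred cube member: `Ineq159FlatCubeMemberCovPrintedZ d L`, `Ineq159FlatDentedCubeMemberCovPrintedZ d L` — NAMED in
`B8Ineq159FlatCovPrintedRec`, UNPROVED in the tree; every other analytic input — Theorem 4 ∕ Prop. 5 ∕ Sect. E of record, the three REAL families ([4] Thms 3.1–3.2 there), the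
axial ∕ Landau bookkeeping — is a theorem of record): there are `B₀ ≥ 1`, `c₁ > 0` and thresholds `ρ₀, M₀, N₀, R₀` such that for every `η > 0`, every dented RECORD cube datum
`c : CubeB8DZ d L K Ω` ([15] (148)–(150), centred tower) on print's p. 98 sub-lattice above threshold (`M_h = Lˢ ≥ 3`, `M₀ ≤ L^{s+1}`, `L^{s+1} ∣ c.ρ`, `L^{s+1} ∣ c.M`,
`R·L^{s+1} ≤ c.ρ`, `2L ≤ R`, `R₀ ≤ R`, `N₀ + 1 ≤ R·L^{s+1}`, `ρ₀ ≤ c.ρ`) whose ambient top member `Ω_k` is a union of `L^{s+1}Lᵏ`-cubes of the grid anchored at `□_k`'s fine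
lower corner `Lᵏ(c.a − c.ρ) − c_k·𝟙` ((1.4)₂), every unitary `U₀ ∈ 𝔄_K({Ω_j}, α₀)` with `7dL²·c.M·α₀ ≤ c₁` (NO further threshold on `α₀`): `GaugedBoundB8DZ L η U₀ c
(7dL²·(5dLB₀)·c.M·α₀)` — a unitary `u` on `□̃`, `= 1` off `Ω′₀`, (1.29) w.r.t. `{Λ′_j}`, the Landau gauge (1.138) of `U₀″^{u⁻¹}` at background `1` over `{Ω′_j}`, (1.136)₁–₄ with
print's constant shape, `w = v⁻¹u` unitary, (1.135), (1.137).  = §2 with its window `5 ≤ d·L` discharged (`L ≥ 5`, `d ≥ 1`).  The premise the R7 door (dag-n07-w3's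
`BalabanUVNodesN07Thm4RecMember*`) consumes, in its quantifier shape.
[cite: Balaban1985RegularSpaces, Prop. 6 (1.135)–(1.138) p.99, p.98, (1.59) p.86, (1.62) p.87, (1.91)–(1.92) p.91, (1.98) p.92, (1.101) p.93, (1.4) p.77; Balaban1985Variational, (148)–(153) p.301, p.300; Balaban1985BackgroundPropagators, (3.14)–(3.15) p.393, Thms 3.1–3.3 pp.398–399; Balaban1984PropagatorsII, Prop. 2.6 (2.136) p.247, Prop. 2.3 (2.87) p.238; Balaban1987RG1, (0.3)–(0.4) pp.252–253] -/
theorem gaugedBoundB8DZ_dentedMember_of_cov159_mem (τ : 𝔸 →L[ℂ] ℂ) (hτ : ∀ x y : 𝔸, τ (x * y) = τ (y * x)) (hd2 : 2 ≤ d) {L sL : ℕ} (hLs : L = 2 * sL + 1) (hs2 : 2 ≤ sL)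
    {G H : Subgroup 𝔸ˣ} (hGrp2 : ∀ g ∈ H, ‖(g : 𝔸) - 1‖ ≤ 1 / 8 → τ (mlog (g : 𝔸)) = 0) (hGrp3 : ∀ S : 𝔸, τ S = 0 → expUnit S ∈ H)
    (hGA : AvgClosedZ d L G) (hGH : G ≤ H) (hGu : G ≤ unitaryUnits 𝔸)
    (hexpG : ∀ lam : Site d → 𝔸, (∀ x, IsSelfAdjoint (lam x)) → (∀ x, τ (lam x) = 0) → ∀ x, gaugeExp lam x ∈ G)
    (h159 : Ineq159FlatCubeMemberCovPrintedZ d L) (h159D : Ineq159FlatDentedCubeMemberCovPrintedZ d L) :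
    ∃ B₀ c₁ ρ₀ M₀ : ℝ, ∃ N₀ R₀ : ℕ, 1 ≤ B₀ ∧ 0 < c₁ ∧ ∀ (η : ℝ), 0 < η → ∀ {K : ℕ} {Ω : ℕ → Set (Site d)} (c : CubeB8DZ d L K Ω),
      -- PRINT'S SIDE CONDITIONS (p. 98) on the cube datum in the named facts' letters (`M_h = Lˢ`), above threshold
      ∀ (s R : ℕ), 3 ≤ L ^ s → M₀ ≤ (L : ℝ) ^ (s + 1) → L ^ (s + 1) ∣ c.ρ → L ^ (s + 1) ∣ c.M → R * L ^ (s + 1) ≤ c.ρ → 2 * L ≤ R →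
        R₀ ≤ R → N₀ + 1 ≤ R * L ^ (s + 1) → ρ₀ ≤ (c.ρ : ℝ) →
      -- THE DENT PREMISE ([6] (1.4)₂): `Ω_k` is a union of cubes of side `L^{s+1}Lᵏ` of the grid anchored at `□_k`'s fine lower corner `Lᵏ(c.a − c.ρ)`
      (∀ x y : Site d,
          blockMap (L ^ (s + 1) * L ^ c.k) (x - fun i => (L : ℤ) ^ c.k * (c.a i - c.ρ) - (ctrShift L c.k : ℤ)) =
            blockMap (L ^ (s + 1) * L ^ c.k) (y - fun i => (L : ℤ) ^ c.k * (c.a i - c.ρ) - (ctrShift L c.k : ℤ)) → x ∈ Ω c.k → y ∈ Ω c.k) →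
      ∀ (U₀ : Site d → Fin d → 𝔸ˣ), (∀ x κ, U₀ x κ ∈ G) → ∀ (α₀ : ℝ), 0 < α₀ → InAk L K η α₀ Ω U₀ →
      7 * d * (L : ℝ) ^ 2 * c.M * α₀ ≤ c₁ →
      ∃ u : Site d → 𝔸ˣ, (∀ x, u x ∈ G) ∧ (∀ x, x ∉ c.sq 0 → u x = 1) ∧
        Restr129Z L c.k c.lamS (1 : Site d → Fin d → 𝔸ˣ) u ∧
        IsLandau138WZ L c.k η (c.sq 0) c.lamS (1 : Site d → Fin d → 𝔸ˣ) (c.fixed U₀ u) ∧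
        (∀ j, j ≤ c.k → ∀ b ∈ {b : Site d × Fin d | SideTouches (c.sq j) b.1 b.2},
          c.fixed U₀ u b.1 b.2 = cfgExp η (logCfg η (c.fixed U₀ u)) b.1 b.2 ∧ IsSelfAdjoint (logCfg η (c.fixed U₀ u) b.1 b.2) ∧
            ‖logCfg η (c.fixed U₀ u) b.1 b.2‖ ≤ (7 * d * (L : ℝ) ^ 2 * (5 * (d : ℝ) * L * B₀) * c.M * α₀) * ((L : ℝ) ^ j * η)⁻¹) ∧
        (∀ x, ((c.vfix U₀)⁻¹ * u) x ∈ G) ∧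
        AgreeOn (tlo L (tLo c.a c.ρ) c.k) (thi L (tHi c.a c.M c.ρ) c.k) (gaugeAct ((c.vfix U₀)⁻¹ * u)⁻¹ U₀) (c.fixed U₀ u) ∧
        msup L c.k η (-(2 : ℝ)) (fun j (t : Fin d × Fin d × Site d) => SideTouches (c.sq j) t.2.2 t.2.1)
            (fun t => covDerivFwd η (1 : Site d → Fin d → 𝔸ˣ) t.1 (fun z => c.expo η U₀ u z t.2.1) t.2.2) ≤ (7 * d * (L : ℝ) ^ 2 * (5 * (d : ℝ) * L * B₀) * c.M * α₀) ∧
        bondNorm L c.k η (-(3 : ℝ)) c.sq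
            (fun x μ => pdiv η (1 : Site d → Fin d → 𝔸ˣ) (plaqCovDeriv η (1 : Site d → Fin d → 𝔸ˣ) (c.expo η U₀ u)) μ x) ≤ (7 * d * (L : ℝ) ^ 2 * (5 * (d : ℝ) * L * B₀) * c.M * α₀) ∧
        bondNorm L c.k η (-(3 : ℝ)) c.sq (fun x μ => covLap η (1 : Site d → Fin d → 𝔸ˣ) (fun z => c.expo η U₀ u z μ) x) ≤ (7 * d * (L : ℝ) ^ 2 * (5 * (d : ℝ) * L * B₀) * c.M * α₀) ∧
        (∀ (x : Site d) (μ : Fin d), bLoZ L c.a 0 0 ≤ x → x + e μ ≤ bHiZ L c.a c.M 0 0 → c.inTop x → c.inTop (x + e μ) →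
          logCovIterZ L (1 : Site d → Fin d → 𝔸ˣ) (iEta η (c.expo η U₀ u)) c.k x μ = mlog ((avgIterZ L (c.axial U₀) c.k x μ : 𝔸ˣ) : 𝔸)) := by
  have hL5 : 5 ≤ L := by omega
  have hd1 : 0 < d := by omega
  exact gaugedBoundB8D_dentedMember_scalar_γ_of_namedFacts_mem (𝔸 := 𝔸) τ hτ hd2 hLs (by omega) hGrp2 hGrp3 hGA hGH hGu hexpG
    (le_trans hL5 (Nat.le_mul_of_pos_left L hd1)) h159 h159D

/-! ## §4 THE RECORD `G`-CROWN, UNCONDITIONALLY: the two named Cov facts DISCHARGED by dag-n05-cov's `ineq159FlatCovPrintedZ_holds` -/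

open Classical in
/-- ★★★ **PROPOSITION 6 (p. 99) AT EVERY DENTED CENTRED CUBE MEMBER OF PRINT's BIG-BLOCK SUB-LATTICE WITH A `G`-VALUED GAUGE TRANSFORMATION, FOR ODD `L = 2s+1 ≥ 5` AND
`d ≥ 2` — UNCONDITIONALLY** (twin of dag-n05-cov's `B8Prop6DentedCubeMemberScalarGammaHoldsRec.gaugedBoundB8DZ_dentedMember_scalar_γ_holds` with the joint J-SU data threaded):
`gaugedBoundB8DZ_dentedMember_of_cov159_mem` with its two named hypotheses ([4] Thm 3.3 ∕ [6] (1.59), (1.62) at `U₀ = 1` for the record's linearised averaging `Q_j(1)`, on the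
pure and on the dented centred member) DISCHARGED by `B8Ineq159FlatCovDentedCubeMemberRec.ineq159FlatCovPrintedZ_holds` (`d = d′ + 1`, `L = ℓ + 1`, `ℓ = 2s ≥ 4`).  For a
subgroup `G ≤ U(𝔸)` closed under the record's averaging with the joint J-SU data `(τ, hτ, H, hGrp2, hGrp3, hGH, hexpG)` ([Balaban1985Averaging] p. 20 «a Lie subgroup G of a
unitary group U(N)»; `G = SU(N)`, `H = SL(N, ℂ)`, `τ = tr` in (G8)): `∃ B₀ ≥ 1, c₁ > 0, ρ₀, M₀, N₀, R₀` such that for every `η > 0`, every dented record cube datum on print's p. 98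
sub-lattice above threshold with the anchored dent premise, every `G`-VALUED `U₀ ∈ 𝔄_K({Ω_j}, α₀)` with `7dL²·c.M·α₀ ≤ c₁`: `GaugedBoundB8DZ`'s twelve clauses with the gauge
transformation `u` AND `w = v⁻¹u` `G`-VALUED.
[cite: Balaban1985RegularSpaces, Prop. 6 (1.135)–(1.138) p.99, p.98, (1.59) p.86, (1.62) p.87, (1.17) p.78; Balaban1985Variational, (148)–(152) p.301, p.300; Balaban1985Averaging, p.20, (42)–(43) pp.23–24; Balaban1985BackgroundPropagators, (3.14)–(3.15) p.393, Thms 3.1–3.3 pp.398–399; Balaban1987RG1, (0.3)–(0.4) pp.252–253] -/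
theorem gaugedBoundB8DZ_dentedMember_scalar_γ_holds_mem (τ : 𝔸 →L[ℂ] ℂ) (hτ : ∀ x y : 𝔸, τ (x * y) = τ (y * x)) (hd2 : 2 ≤ d) {L sL : ℕ} (hLs : L = 2 * sL + 1)
    (hs2 : 2 ≤ sL)
    {G H : Subgroup 𝔸ˣ} (hGrp2 : ∀ g ∈ H, ‖(g : 𝔸) - 1‖ ≤ 1 / 8 → τ (mlog (g : 𝔸)) = 0) (hGrp3 : ∀ S : 𝔸, τ S = 0 → expUnit S ∈ H)
    (hGA : AvgClosedZ d L G) (hGH : G ≤ H) (hGu : G ≤ unitaryUnits 𝔸)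
    (hexpG : ∀ lam : Site d → 𝔸, (∀ x, IsSelfAdjoint (lam x)) → (∀ x, τ (lam x) = 0) → ∀ x, gaugeExp lam x ∈ G)
 :
    ∃ B₀ c₁ ρ₀ M₀ : ℝ, ∃ N₀ R₀ : ℕ, 1 ≤ B₀ ∧ 0 < c₁ ∧ ∀ (η : ℝ), 0 < η → ∀ {K : ℕ} {Ω : ℕ → Set (Site d)} (c : CubeB8DZ d L K Ω),
      ∀ (s R : ℕ), 3 ≤ L ^ s → M₀ ≤ (L : ℝ) ^ (s + 1) → L ^ (s + 1) ∣ c.ρ → L ^ (s + 1) ∣ c.M → R * L ^ (s + 1) ≤ c.ρ → 2 * L ≤ R →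
        R₀ ≤ R → N₀ + 1 ≤ R * L ^ (s + 1) → ρ₀ ≤ (c.ρ : ℝ) →
      (∀ x y : Site d,
          blockMap (L ^ (s + 1) * L ^ c.k) (x - fun i => (L : ℤ) ^ c.k * (c.a i - c.ρ) - (ctrShift L c.k : ℤ)) =
            blockMap (L ^ (s + 1) * L ^ c.k) (y - fun i => (L : ℤ) ^ c.k * (c.a i - c.ρ) - (ctrShift L c.k : ℤ)) → x ∈ Ω c.k → y ∈ Ω c.k) →
      ∀ (U₀ : Site d → Fin d → 𝔸ˣ), (∀ x κ, U₀ x κ ∈ G) → ∀ (α₀ : ℝ), 0 < α₀ → InAk L K η α₀ Ω U₀ →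
      7 * d * (L : ℝ) ^ 2 * c.M * α₀ ≤ c₁ →
      ∃ u : Site d → 𝔸ˣ, (∀ x, u x ∈ G) ∧ (∀ x, x ∉ c.sq 0 → u x = 1) ∧
        Restr129Z L c.k c.lamS (1 : Site d → Fin d → 𝔸ˣ) u ∧
        IsLandau138WZ L c.k η (c.sq 0) c.lamS (1 : Site d → Fin d → 𝔸ˣ) (c.fixed U₀ u) ∧
        (∀ j, j ≤ c.k → ∀ b ∈ {b : Site d × Fin d | SideTouches (c.sq j) b.1 b.2},
          c.fixed U₀ u b.1 b.2 = cfgExp η (logCfg η (c.fixed U₀ u)) b.1 b.2 ∧ IsSelfAdjoint (logCfg η (c.fixed U₀ u) b.1 b.2) ∧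
            ‖logCfg η (c.fixed U₀ u) b.1 b.2‖ ≤ (7 * d * (L : ℝ) ^ 2 * (5 * (d : ℝ) * L * B₀) * c.M * α₀) * ((L : ℝ) ^ j * η)⁻¹) ∧
        (∀ x, ((c.vfix U₀)⁻¹ * u) x ∈ G) ∧
        AgreeOn (tlo L (tLo c.a c.ρ) c.k) (thi L (tHi c.a c.M c.ρ) c.k) (gaugeAct ((c.vfix U₀)⁻¹ * u)⁻¹ U₀) (c.fixed U₀ u) ∧
        msup L c.k η (-(2 : ℝ)) (fun j (t : Fin d × Fin d × Site d) => SideTouches (c.sq j) t.2.2 t.2.1)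
            (fun t => covDerivFwd η (1 : Site d → Fin d → 𝔸ˣ) t.1 (fun z => c.expo η U₀ u z t.2.1) t.2.2) ≤ (7 * d * (L : ℝ) ^ 2 * (5 * (d : ℝ) * L * B₀) * c.M * α₀) ∧
        bondNorm L c.k η (-(3 : ℝ)) c.sq
            (fun x μ => pdiv η (1 : Site d → Fin d → 𝔸ˣ) (plaqCovDeriv η (1 : Site d → Fin d → 𝔸ˣ) (c.expo η U₀ u)) μ x) ≤ (7 * d * (L : ℝ) ^ 2 * (5 * (d : ℝ) * L * B₀) * c.M * α₀) ∧
        bondNorm L c.k η (-(3 : ℝ)) c.sq (fun x μ => covLap η (1 : Site d → Fin d → 𝔸ˣ) (fun z => c.expo η U₀ u z μ) x) ≤ (7 * d * (L : ℝ) ^ 2 * (5 * (d : ℝ) * L * B₀) * c.M * α₀) ∧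
        (∀ (x : Site d) (μ : Fin d), bLoZ L c.a 0 0 ≤ x → x + e μ ≤ bHiZ L c.a c.M 0 0 → c.inTop x → c.inTop (x + e μ) →
          logCovIterZ L (1 : Site d → Fin d → 𝔸ˣ) (iEta η (c.expo η U₀ u)) c.k x μ = mlog ((avgIterZ L (c.axial U₀) c.k x μ : 𝔸ˣ) : 𝔸)) := by
  obtain ⟨d', rfl⟩ : ∃ d', d = d' + 1 := ⟨d - 1, by omega⟩
  obtain ⟨ℓ, rfl⟩ : ∃ ℓ, L = ℓ + 1 := ⟨2 * sL, by omega⟩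
  have h := ineq159FlatCovPrintedZ_holds d' ℓ (by omega) ⟨sL, by omega⟩
  exact gaugedBoundB8DZ_dentedMember_of_cov159_mem (𝔸 := 𝔸) τ hτ hd2 hLs hs2 hGrp2 hGrp3 hGA hGH hGu hexpG h.1 h.2

#print axioms gaugedBoundB8DZ_dentedMember_scalar_γ_holds_mem

end Literature.MathematicalPhysics.QuantumFieldTheory.Balaban1983to89.B8Prop6DentedCubeMemberScalarGammaOfNamedFactsGRec

end
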